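import Summits.BirchSwinnertonDyer.BirchSwinnertonDyer.Theorems.GoldfeldK12AdditiveTwoHalfTraceOfShimuraReciprocity
import Summits.BirchSwinnertonDyer.BirchSwinnertonDyer.Theorems.GoldfeldK12AdditiveTwoHalfTrace
import HarnessLib

set_option linter.dupNamespace false -- namespace `…BirchSwinnertonDyer.BirchSwinnertonDyer…` is the cell's (D-0017 nested layout)
set_option autoImplicit false

/-!
# `X049GenusHalfTraceDatum` FROM SHIMURA RECIPROCITY, and the four consumers of `X049GenusHalfTraceFiveModEight`
# re-derived with the conjecture binder replaced by named print + three residual named inputs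

Cell `bsd-goldfeld`, seat `bsd-goldfeld-s1p-c201` (prover, gen 13), order `ROUTE-S1PLUS/planner-g30/c201_GO.txt`;
`--supports stmt-BirchSwinnertonDyer-20044` (route decl
`Summit.BirchSwinnertonDyer.BirchSwinnertonDyer.Theses.GoldfeldAllTwistsTwoConverse.RankOneTwoConverseCMSevenAdditiveTwo`,
K12₂″). HONEST FRAMING: nothing here proves K12₂″ or BSD; the family `49a1^{(−q)}`, `q ≡ 5 (mod 8)` prime, has
twist-density zero (a witness family, never a closer of item 20044).
In the Theses import cone of `GoldfeldK12AdditiveTwoHalfTrace` (consumers; no definition).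

* §9 the Fricke sign: `f|w_N = −w(E)·f` at the conductor level (Hecke + Atkin–Lehner, tree `_holds` theorems via
  `rootNumber_eq_neg_frickeEigenvalue`), hence **`f₄₉|w₄₉ = −f₄₉`** from `w(49a1) = +1` (`rootNumber_cm7`, CLTZ Thm. 1.2
  at `R = 1`); the ASSEMBLY `nonempty_genusHalfTraceDatum_of_data` of the datum from abstract genus-field data (the
  transport `Φ : X₀(49)(L) ≃+ E₊(L)` is the change of variables `C₁`, `smul_cm7_eq_twoTorsionModel`, `T ↦ (0,0)`,
  Galois-equivariant by `pointEquivBaseChange_map_algEquiv`); and **`nonempty_genusHalfTraceDatum_of_shimuraReciprocity`**: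
  for every prime `q ≡ 5 (mod 8)` with `(q/7) = −1`, `K` with `d_K = −4q`, datum `Dt`, Heegner datum `H`, `ι`, and
  `P ↦ Σ φ_{Dt}(τ_Q)`: `Nonempty (X049GenusHalfTraceDatum K Dt.c P)` from
  - `hSR : heegnerPoints_shimuraReciprocity 49 cm7 K` (Darmon Thm. 3.7, named fact, typer p527359) — conjunct (a);
  - `hM : OptimalCurveManinCertificate cm7` (aside 20085: a Manin-`±1` datum `D₀`, Agashe–Ribet–Stein Thm. 2.6);
  - `h12 : CoatesLiTianZhai2015.thm12_fullBSD_twist` (only for `w(49a1) = +1`, the Fricke sign);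
  - RESIDUAL (b₂) `hodd`: `#Cl(𝒪_{−4q})²` odd (Rédei–Reichardt: `4`-rank `0` iff `q ≡ 5 (mod 8)`; the `2`-rank part,
    `[Cl : Cl²] = 2`, IS discharged in `…GenusField` from the landed Gauss count);
  - RESIDUAL (c) `hram`: for every field `J` with `[J : ℚ] = 4`, `i² = −1`, `r² = q`, and `σ ∈ Aut(J)` with
    `σ i = i`, `σ r = −r` (so `J = ℚ(i, √q)`, `σ` generates `Gal(J/ℚ(i))`), a valuation `w : J → ℝ≥0` above `q` with
    `σ` inertial, `w(2) = w(7) = 1` (each prime of `ℚ(i)` above `q ≡ 1 (mod 4)` ramifies in `J`);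
  - RESIDUAL (d) `hcusp`: `φ_{D₀}(0) = (2, −1)` for every datum of `X₀(49)` at level `49` with `|c| = 1`
    (`L(49a1, 1)/Ω⁺ = 1/2`; NOT implied by `hM`, which only gives `|c| = 1`).
* §10 the consumers `…_of_shimuraReciprocity`: clause (i) of B49 for `q ≡ 5 (mod 8)` (Heegner points over `ℚ(√−q)` are
  non-torsion), the sub-leaf without Selmer hypothesis, `ord_{s=1} L(X₀(49)/K, s) = 1`, «Conjecture D(q)»
  `r_an(49a1^{(−q)}) = 1`, and K12₂″'s implication on the family — the four theorems of
  `GoldfeldK12AdditiveTwoHalfTrace.lean` §5 with `hHT : X049GenusHalfTraceFiveModEight` replaced by the inputs above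
  (new names; the old theorems stay).

References: [GrossLMS1991] Prop. 5.3; [Darmon2004] Thm. 3.6–3.7, (2.13)–(2.17); [Gross1984] §§I.1, 5;
[CoatesLiTianZhai2015] Thm. 1.2, 1.4, Thm. 2.2; [AgasheRibetStein2006] Thm. 2.6; [GrossZagier1986] I.(6.3);
[SilvermanAEC2009] III.3.1(b), VIII.1.5(b), X.4.9; [BurungaleCastellaSkinnerTian2022] Rem. D;
[RedeiReichardt1934] (residual (b₂)); [Cox2013] §6.A.
-/

noncomputable section

open scoped Classical ComplexConjugate NNReal

open Literature.NumberTheory.EllipticCurves.ModularForms NumberField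
open Literature.Computability.Cryptography.Hallgren2005
open Literature.Computability.Cryptography.Hallgren2005.OrderCl
open Literature.NumberTheory.QuadraticFields.Quadratic

namespace Summit.BirchSwinnertonDyer.BirchSwinnertonDyer.Theorems.GoldfeldGoodTwists

open WeierstrassCurve Literature.NumberTheory.EllipticCurves

/-! ## §9 (cone) The Fricke sign of `X₀(49)` and the genus-field half-trace datum -/

section Datum

open Literature.NumberTheory.EllipticCurves.ModularForms ModularForms

/-- **`w(E) = -ε(f)` as a Fricke eigen-relation**: the newform of an elliptic `W/ℚ` at the conductor level satisfies
`f|w_N = -w(E) · f` pointwise. [cite: Darmon2004, (2.13)–(2.17)] -/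
theorem isFrickeEigen_neg_rootNumber (W : WeierstrassCurve ℚ) [W.IsElliptic] [NeZero (W.conductorNorm ℤ)]
    (Dt : ModularParametrizationData W (W.conductorNorm ℤ)) :
    IsFrickeEigen (W.conductorNorm ℤ) Dt.f (-(W.rootNumber : ℂ)) := by
  have hw : (W.rootNumber : ℂ) = -frickeEigenvalue Dt.f :=
    rootNumber_eq_neg_frickeEigenvalue (fun _ _ ↦ IsNewform0.exists_functional_equation_holds)
      (fun _ _ ↦ IsNewform0.frickeEigenvalue_eq_one_or_eq_neg_one_holds) Dt.isNewformOf
  have hsm := IsNewform0.frickeInvolution_eq_smul_holds (N := W.conductorNorm ℤ) (k := (2 : ℤ)) Dt.isNewformOf.1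
  rw [hw, neg_neg]
  exact isFrickeEigen_of_frickeInvolution_eq_smul _ hsm

/-- **The Fricke sign of `X₀(49)` is `-1`** (`w(49a1) = +1`, from `L(X₀(49), 1) ≠ 0`, CLTZ Thm. 1.2 at `R = 1`):
`f₄₉|w₄₉ = -f₄₉`. [cite: CoatesLiTianZhai2015, Thm. 1.2 (p. 359, case r = 0)] [cite: Darmon2004, (2.17)] -/
theorem isFrickeEigen_cm7_neg_one (h12 : CoatesLiTianZhai2015.thm12_fullBSD_twist)
    (D₀ : ModularParametrizationData cm7 49) : IsFrickeEigen 49 D₀.f ((-1 : ℤ) : ℂ) := by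
  have key : ∀ (M : ℕ) [NeZero M], M = cm7.conductorNorm ℤ → ∀ D : ModularParametrizationData cm7 M,
      IsFrickeEigen M D.f (-(cm7.rootNumber : ℂ)) := by
    intro M _ hM D
    subst hM
    exact isFrickeEigen_neg_rootNumber cm7 D
  have h := key 49 conductorNorm_cm7.symm D₀
  rw [rootNumber_cm7 h12] at h
  exact_mod_cast h

/-- transport of `congrEquiv` along base change commutes with the Galois action on points. [folklore] -/
theorem congrEquiv_map {V₁ V₂ : WeierstrassCurve ℚ} (h : V₁ = V₂) {L : Type*} [Field L] [Algebra ℚ L]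
    [DecidableEq L] (σ : L →ₐ[ℚ] L) (Q : (V₁.baseChange L).toAffine.Point) :
    Affine.Point.congrEquiv (congrArg (fun V : WeierstrassCurve ℚ ↦ V.baseChange L) h) (Affine.Point.map σ Q) =
      Affine.Point.map σ (Affine.Point.congrEquiv (congrArg (fun V : WeierstrassCurve ℚ ↦ V.baseChange L) h) Q) := by
  subst h
  rfl


/-- `|c| = 1` forces `c • T = T` for a `2`-torsion point `T`. [folklore] -/
theorem zsmul_eq_self_of_abs_eq_one {A : Type*} [AddCommGroup A] {c : ℤ} (hc : |c| = 1) {T : A} (hT : T + T = 0) :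
    c • T = T := by
  rcases abs_eq (zero_le_one' ℤ) |>.mp hc with rfl | rfl
  · rw [one_zsmul]
  · rw [neg_one_zsmul, neg_eq_iff_add_eq_zero, hT]

/-- **Assembly of the datum from abstract genus-field data** (`L` any field: the involutions `ρ`, `τ`, the element `i`,
a valuation `w` with `ρτ` inertial, and the points `Y ∈ X₀(49)(K)`, `z ∈ X₀(49)(L)` with `P = c·c₀·Y`, `Y = z + ρz`,
`z + τz = T`); the transport to `E₊` is the change of variables `C₁` (`smul_cm7_eq_twoTorsionModel`).
[cite: GrossLMS1991, Prop. 5.3] [cite: SilvermanAEC2009, III.3.1(b)] -/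
theorem nonempty_genusHalfTraceDatum_of_data {K : Type} [Field K] [NumberField K] {c c₀ : ℤ} (hc₀ : |c₀| = 1)
    {P Y : (cm7.baseChange K).toAffine.Point} (L : Type) [Field L] [CharZero L] (j : K →+* L)
    (ρ τ : L ≃ₐ[ℚ] L) (i : L) (w : Valuation L ℝ≥0) (z : (cm7.baseChange L).toAffine.Point)
    (hi : i ^ 2 = -1) (hτi : τ i = -i) (hfix : ∀ x : L, ρ (τ x) = x → ∃ u v : ℚ, x = u + v * i)
    (h7 : ∀ x : L, x ^ 2 ≠ -7) (hw1 : ∀ x, w (ρ (τ x)) = w x) (hw2 : ∀ x, w x ≤ 1 → w (ρ (τ x) - x) < 1)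
    (hw3 : w 2 = 1) (hw4 : w 7 = 1) (hPY : P = c • (c₀ • Y))
    (hYz : Affine.Point.map j.toRatAlgHom Y = z + Affine.Point.map ρ.toAlgHom z)
    (hzτ : z + Affine.Point.map τ.toAlgHom z = Affine.Point.some 2 (-1) (nonsingular_cm7_baseChange_two_neg_one L)) :
    Nonempty (X049GenusHalfTraceDatum K c P) := by
  -- the transport `Φ : X₀(49)(L) ≃+ E₊(L)`
  have hE : ((⟨(Units.mk0 (2 : ℚ) two_ne_zero)⁻¹, 2, -1 / 2, -1⟩ : VariableChange ℚ) • cm7).baseChange L =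
      ((⟨0, 21, 0, 112, 0⟩ : WeierstrassCurve ℚ).baseChange L) :=
    congrArg (fun V : WeierstrassCurve ℚ ↦ V.baseChange L) smul_cm7_eq_twoTorsionModel
  set Φ := ((VariableChange.pointEquivBaseChange cm7 (⟨(Units.mk0 (2 : ℚ) two_ne_zero)⁻¹, 2, -1 / 2, -1⟩ :
      VariableChange ℚ) L).trans (Affine.Point.congrEquiv hE)) with hΦ_def
  have hΦσ : ∀ (σ : L ≃ₐ[ℚ] L) (Q : (cm7.baseChange L).toAffine.Point),
      Φ (Affine.Point.map σ.toAlgHom Q) = Affine.Point.map σ.toAlgHom (Φ Q) := by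
    intro σ Q
    rw [hΦ_def, AddEquiv.trans_apply, AddEquiv.trans_apply, VariableChange.pointEquivBaseChange_map_algEquiv]
    exact congrEquiv_map smul_cm7_eq_twoTorsionModel _ _
  have hΦT : Φ (Affine.Point.some 2 (-1) (nonsingular_cm7_baseChange_two_neg_one L)) =
      Affine.Point.some 0 0 (nonsingular_zero_zero_twoTorsionModel L) := by
    rw [hΦ_def, AddEquiv.trans_apply, VariableChange.pointEquivBaseChange_some, Affine.Point.congrEquiv_some,
      Affine.Point.some.injEq]
    simp only [VariableChange.toX_def, VariableChange.toY_def, VariableChange.map]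
    constructor <;> simp
  haveI := isElliptic_twoTorsionModel_baseChange L
  have hT2 := twoTorsionPoint_add_twoTorsionPoint (((⟨0, 21, 0, 112, 0⟩ : WeierstrassCurve ℚ).baseChange L))
  refine ⟨⟨L, j, ρ, τ, i, w, Φ.toAddMonoidHom, c₀ • Y, c₀ • Φ z, hi, hτi, hfix, h7, hw1, hw2, hw3, hw4, Φ.injective,
    hPY, ?_, ?_⟩⟩
  · -- `Φ(y₀) = z + ρ z`
    show Φ (Affine.Point.map j.toRatAlgHom (c₀ • Y)) = c₀ • Φ z + Affine.Point.map ρ.toAlgHom (c₀ • Φ z)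
    rw [map_zsmul, hYz, map_zsmul, map_add, hΦσ, map_zsmul, smul_add]
  · -- `z + τ z = T₊`
    show c₀ • Φ z + Affine.Point.map τ.toAlgHom (c₀ • Φ z) = _
    rw [map_zsmul, ← smul_add, ← hΦσ, ← map_add, hzτ, hΦT]
    exact zsmul_eq_self_of_abs_eq_one hc₀ hT2

/-- **THE GENUS-FIELD HALF-TRACE DATUM EXISTS** for every level-`49` Heegner point over `ℚ(√-q)`, `q ≡ 5 (mod 8)`,
from Shimura reciprocity, modulo the named residual inputs (b₂) `#Cl(-4q)²` odd, (c) ramification of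
`ℚ(i, √-q)/ℚ(i)` at `q`, (d) `φ(0) = (2,-1)` for Manin-`±1` parametrisations, and CLTZ Thm. 1.2 (sign).
[cite: GrossLMS1991, Prop. 5.3 and proof] [cite: Darmon2004, Thm. 3.7] [cite: Cox2013, §6.A Thm. 6.1]
[cite: CoatesLiTianZhai2015, Thm. 1.2] [cite: AgasheRibetStein2006, Thm. 2.6] -/
theorem nonempty_genusHalfTraceDatum_of_shimuraReciprocity {K : Type} [Field K] [NumberField K]
    (hSR : heegnerPoints_shimuraReciprocity 49 cm7 K) (hM : OptimalCurveManinCertificate cm7)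
    (h12 : CoatesLiTianZhai2015.thm12_fullBSD_twist) {q : ℕ}
    (hodd : ∀ Δ : OrderCl.NegDiscr, Δ.D = -(4 * (q : ℤ)) →
      Odd (Nat.card ((powMonoidHom 2 : ClassGroup (OrderCl.QO Δ) →* ClassGroup (OrderCl.QO Δ)).range)))
    (hram : ∀ (J : Type) [Field J] [CharZero J], Module.finrank ℚ J = 4 →
      ∀ (σ : J ≃ₐ[ℚ] J) (i r : J), i ^ 2 = -1 → r ^ 2 = (q : J) → σ i = i → σ r = -r →
      ∃ w : Valuation J ℝ≥0, (∀ x, w (σ x) = w x) ∧ (∀ x, w x ≤ 1 → w (σ x - x) < 1) ∧ w 2 = 1 ∧ w 7 = 1)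
    (hcusp : ∀ D₀ : ModularParametrizationData cm7 49, |D₀.c| = 1 →
      D₀.cuspZeroPoint = Affine.Point.some 2 (-1) (nonsingular_cm7_baseChange_two_neg_one ℂ))
    (hq : q.Prime) (hq8 : q % 8 = 5) (hq7 : jacobiSym q 7 = -1) (hK : IsImaginaryQuadratic K)
    (hdK : NumberField.discr K = -(4 * (q : ℤ))) (Dt : ModularParametrizationData cm7 49)
    (H : HeegnerDatum 49 (NumberField.discr K)) (ι : K →+* ℂ) {P : (cm7.baseChange K).toAffine.Point}
    (hP : Affine.Point.map ι.toRatAlgHom P = heegnerPointComplex Dt H) :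
    Nonempty (X049GenusHalfTraceDatum K Dt.c P) := by
  have hq4 : q % 4 = 1 := by omega
  have hq7' : q ≠ 7 := by rintro rfl; norm_num [jacobiSym] at hq7
  have hH : SatisfiesHeegnerHypothesis 49 K :=
    satisfiesHeegnerHypothesis_fortyNine_of_discr_eq K hK.1 (by rw [hdK]; ring) (jacobiSym_neg_prime_seven hq7)
  -- a Manin-`±1` datum at level `49`
  obtain ⟨D₀, hD₀⟩ : ∃ D₀ : ModularParametrizationData cm7 49, |D₀.c| = 1 := by
    obtain ⟨hN, D, -, hD, -⟩ := hM.exists_optimalDatum_abs_maninConstant_eq_one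
    have key : ∀ (M : ℕ) [NeZero M], M = 49 → ∀ D : ModularParametrizationData cm7 M, |D.c| = 1 →
        ∃ D₀ : ModularParametrizationData cm7 49, |D₀.c| = 1 := by
      intro M _ hM D hD; subst hM; exact ⟨D, hD⟩
    exact key _ conductorNorm_cm7 D hD
  -- all the genus-field data
  obtain ⟨J, ρ, τ, sJ, i, z, Y, hJ4, hi, hs, hτi, hρi, hτs, hρs, hfix, h7, hPY, hYz, hzτ⟩ :=
    exists_genusHalfTrace_data hSR hK hH hq hq4 hq7' hdK Dt D₀ hD₀ H ι (isFrickeEigen_cm7_neg_one h12 D₀)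
      (hodd hK.negDiscr (by rw [IsImaginaryQuadratic.negDiscr_D, hdK])) (hcusp D₀ hD₀) hP
  -- the valuation above `q` (residual input (c))
  obtain ⟨w, hw1, hw2, hw3, hw4⟩ := hram J hJ4 (τ.trans ρ) i sJ hi hs
    (by rw [AlgEquiv.trans_apply, hτi, map_neg, hρi, neg_neg]) (by rw [AlgEquiv.trans_apply, hτs, hρs])
  refine nonempty_genusHalfTraceDatum_of_data hD₀ J (algebraMap K J) ρ τ i w z hi hτi hfix h7 (fun x ↦ hw1 x)
    (fun x hx ↦ hw2 x hx) hw3 hw4 hPY ?_ ?_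
  · -- (the two point-group structures on `X₀(49)(J)` differ only in the `DecidableEq` instance)
    convert hYz
  · convert hzτ


/-! ## §10 (cone) The four consumers of `X049GenusHalfTraceFiveModEight`, re-derived from Shimura reciprocity -/

/-- **Clause (i) of LINE B49 for `q ≡ 5 (mod 8)` from Shimura reciprocity**: every level-`49` Heegner point of
`X₀(49)` over `K = ℚ(√-q)` has infinite order — `not_isOfFinAddOrder_heegnerPoint_fiveModEight` with its conjecture
binder `X049GenusHalfTraceFiveModEight` REPLACED by the named fact `heegnerPoints_shimuraReciprocity 49 cm7 K` (Darmon
Thm. 3.7), the Manin certificate of `49a1`, CLTZ Thm. 1.2 (sign of `X₀(49)`), and the residual inputs (b₂) `#Cl(-4q)²`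
odd (Rédei), (c) ramification of `ℚ(i,√-q)/ℚ(i)` at `q`, (d) `φ(0) = (2,-1)` (= `L(49a1,1)/Ω⁺ = 1/2`).
[cite: GrossLMS1991, Prop. 5.3] [cite: Darmon2004, Thm. 3.7] [cite: CoatesLiTianZhai2015, Thm. 1.2 and Thm. 2.2] -/
theorem not_isOfFinAddOrder_heegnerPoint_fiveModEight_of_shimuraReciprocity {K : Type} [Field K] [NumberField K]
    (hSR : heegnerPoints_shimuraReciprocity 49 cm7 K) (hM : OptimalCurveManinCertificate cm7)
    (h12 : CoatesLiTianZhai2015.thm12_fullBSD_twist) {q : ℕ}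
    (hodd : ∀ Δ : OrderCl.NegDiscr, Δ.D = -(4 * (q : ℤ)) →
      Odd (Nat.card ((powMonoidHom 2 : ClassGroup (OrderCl.QO Δ) →* ClassGroup (OrderCl.QO Δ)).range)))
    (hram : ∀ (J : Type) [Field J] [CharZero J], Module.finrank ℚ J = 4 →
      ∀ (σ : J ≃ₐ[ℚ] J) (i r : J), i ^ 2 = -1 → r ^ 2 = (q : J) → σ i = i → σ r = -r →
      ∃ w : Valuation J ℝ≥0, (∀ x, w (σ x) = w x) ∧ (∀ x, w x ≤ 1 → w (σ x - x) < 1) ∧ w 2 = 1 ∧ w 7 = 1)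
    (hcusp : ∀ D₀ : ModularParametrizationData cm7 49, |D₀.c| = 1 →
      D₀.cuspZeroPoint = Affine.Point.some 2 (-1) (nonsingular_cm7_baseChange_two_neg_one ℂ))
    (hq : q.Prime) (hq8 : q % 8 = 5) (hq7 : jacobiSym q 7 = -1) (hK : IsImaginaryQuadratic K)
    (hdK : NumberField.discr K = -(4 * (q : ℤ))) {P : (cm7.baseChange K).toAffine.Point}
    (hP : IsHeegnerPoint 49 cm7 K P) : ¬ IsOfFinAddOrder P := by
  obtain ⟨Dt, H, ι, hPH⟩ := hP
  obtain ⟨D⟩ := nonempty_genusHalfTraceDatum_of_shimuraReciprocity hSR hM h12 hodd hram hcusp hq hq8 hq7 hK hdK Dt H ι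
    hPH
  exact not_isOfFinAddOrder_of_genusHalfTraceDatum Dt.maninConstant_ne_zero_holds D

/-- **The sub-leaf `X049HeegnerNonTorsionEvenDiscr` at `ℚ(√-q)`, `q ≡ 5 (mod 8)`, WITHOUT its Selmer hypothesis**, from
Shimura reciprocity and the residual inputs (all as `∀ q`-schemas). [cite: GrossLMS1991, Prop. 5.3] [cite: Darmon2004, Thm. 3.7] -/
theorem heegnerNonTorsionEvenDiscr_fiveModEight_of_shimuraReciprocity
    (hSR : ∀ (K : Type) [Field K] [NumberField K], heegnerPoints_shimuraReciprocity 49 cm7 K)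
    (hM : OptimalCurveManinCertificate cm7) (h12 : CoatesLiTianZhai2015.thm12_fullBSD_twist)
    (hodd : ∀ (q : ℕ) (Δ : OrderCl.NegDiscr), q.Prime → q % 8 = 5 → Δ.D = -(4 * (q : ℤ)) →
      Odd (Nat.card ((powMonoidHom 2 : ClassGroup (OrderCl.QO Δ) →* ClassGroup (OrderCl.QO Δ)).range)))
    (hram : ∀ (q : ℕ), q.Prime → q % 4 = 1 → ∀ (J : Type) [Field J] [CharZero J], Module.finrank ℚ J = 4 →
      ∀ (σ : J ≃ₐ[ℚ] J) (i r : J), i ^ 2 = -1 → r ^ 2 = (q : J) → σ i = i → σ r = -r →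
      ∃ w : Valuation J ℝ≥0, (∀ x, w (σ x) = w x) ∧ (∀ x, w x ≤ 1 → w (σ x - x) < 1) ∧ w 2 = 1 ∧ w 7 = 1)
    (hcusp : ∀ D₀ : ModularParametrizationData cm7 49, |D₀.c| = 1 →
      D₀.cuspZeroPoint = Affine.Point.some 2 (-1) (nonsingular_cm7_baseChange_two_neg_one ℂ)) :
    ∀ (q : ℕ) (K : Type) [Field K] [NumberField K], q.Prime → q % 8 = 5 → jacobiSym q 7 = -1 →
      IsImaginaryQuadratic K → NumberField.discr K = -(4 * (q : ℤ)) →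
      ∀ (P : (cm7.baseChange K).toAffine.Point), IsHeegnerPoint 49 cm7 K P → ¬ IsOfFinAddOrder P :=
  fun q K _ _ hq hq8 hq7 hK hdK _ hP ↦
    not_isOfFinAddOrder_heegnerPoint_fiveModEight_of_shimuraReciprocity (hSR K) hM h12
      (fun Δ hΔ ↦ hodd q Δ hq hq8 hΔ) (hram q hq (by omega)) hcusp hq hq8 hq7 hK hdK hP

/-- **`ord_{s=1} L(X₀(49)/ℚ(√-q), s) = 1` for `q ≡ 5 (mod 8)`, `(q/7) = -1`, from Shimura reciprocity** (and
Modularity, Gross–Zagier, Heegner rationality, the Manin certificate, CLTZ Thm. 1.2, the residual inputs): verbatim the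
route of `analyticRankEK_cm7_eq_one_fiveModEight`. [cite: GrossZagier1986, Thm. I.(6.3) with V.§2 and I.§7]
[cite: Darmon2004, Thm. 3.7] -/
theorem analyticRankEK_cm7_eq_one_fiveModEight_of_shimuraReciprocity (hnf : ModularForms.exists_isNewformOf)
    (hGZ : ∀ (N : ℕ) [NeZero N] (W : WeierstrassCurve ℚ) (K : Type) [Field K] [NumberField K],
      gross_zagier N W K)
    (hHP : ∀ (W : WeierstrassCurve ℚ) (K : Type) [Field K] [NumberField K], exists_isHeegnerPoint W K)
    (hSR : ∀ (K : Type) [Field K] [NumberField K], heegnerPoints_shimuraReciprocity 49 cm7 K)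
    (hM : OptimalCurveManinCertificate cm7) (h12 : CoatesLiTianZhai2015.thm12_fullBSD_twist)
    (hodd : ∀ (q : ℕ) (Δ : OrderCl.NegDiscr), q.Prime → q % 8 = 5 → Δ.D = -(4 * (q : ℤ)) →
      Odd (Nat.card ((powMonoidHom 2 : ClassGroup (OrderCl.QO Δ) →* ClassGroup (OrderCl.QO Δ)).range)))
    (hram : ∀ (q : ℕ), q.Prime → q % 4 = 1 → ∀ (J : Type) [Field J] [CharZero J], Module.finrank ℚ J = 4 →
      ∀ (σ : J ≃ₐ[ℚ] J) (i r : J), i ^ 2 = -1 → r ^ 2 = (q : J) → σ i = i → σ r = -r →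
      ∃ w : Valuation J ℝ≥0, (∀ x, w (σ x) = w x) ∧ (∀ x, w x ≤ 1 → w (σ x - x) < 1) ∧ w 2 = 1 ∧ w 7 = 1)
    (hcusp : ∀ D₀ : ModularParametrizationData cm7 49, |D₀.c| = 1 →
      D₀.cuspZeroPoint = Affine.Point.some 2 (-1) (nonsingular_cm7_baseChange_two_neg_one ℂ))
    {q : ℕ} (hq : q.Prime) (hq8 : q % 8 = 5) (hq7 : jacobiSym q 7 = -1) (K : Type) [Field K] [NumberField K]
    (hK : IsImaginaryQuadratic K) (hdK : NumberField.discr K = -(4 * (q : ℤ))) : analyticRankEK cm7 K = 1 := by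
  haveI : NeZero (cm7.conductorNorm ℤ) := ⟨(cm7.conductorNorm_pos_holds).ne'⟩
  have hdK' : NumberField.discr K = 4 * (-(q : ℤ)) := by rw [hdK]; ring
  have hH : SatisfiesHeegnerHypothesis 49 K :=
    satisfiesHeegnerHypothesis_fortyNine_of_discr_eq K hK.1 hdK' (jacobiSym_neg_prime_seven hq7)
  have hH' : SatisfiesHeegnerHypothesis (cm7.conductorNorm ℤ) K := by rw [conductorNorm_cm7]; exact hH
  obtain ⟨P, hP0⟩ := hHP cm7 K hK hH'
  have hP : IsHeegnerPoint 49 cm7 K P := isHeegnerPoint_of_level_eq conductorNorm_cm7 hP0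
  exact (analyticRankEK_eq_one_iff_heegner_nonTorsion_of_exists_isNewformOf cm7 49 K (hGZ 49 cm7 K) hnf
    hK conductorNorm_cm7 hH hP).mpr
    (heegnerNonTorsionEvenDiscr_fiveModEight_of_shimuraReciprocity hSR hM h12 hodd hram hcusp q K hq hq8 hq7 hK
      hdK P hP)

/-- **«CONJECTURE D(q)» for `q ≡ 5 (mod 8)` from Shimura reciprocity: `ord_{s=1} L(W, s) = 1` for EVERY elliptic `W/ℚ`
isomorphic to `49a1^{(-q)}`, `q ≡ 5 (mod 8)` prime with `(q/7) = -1`** — the CONCLUSION of K12₂″ (item 20044) on this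
infinite sub-family of the additive cell, modulo Modularity, CLTZ Thm. 1.2, Gross–Zagier, Heegner rationality, Darmon
Thm. 3.7, the Manin certificate and the residual inputs (b₂), (c), (d). Verbatim the route of
`analyticRank_eq_one_inertPrimeTwist_fiveModEight`. [cite: CoatesLiTianZhai2015, Thm. 1.2 and Thm. 1.4]
[cite: GrossZagier1986, Thm. I.(6.3) and I.§7] [cite: Darmon2004, Thm. 3.7] -/
theorem analyticRank_eq_one_inertPrimeTwist_fiveModEight_of_shimuraReciprocity
    (hnf : ModularForms.exists_isNewformOf) (h12 : CoatesLiTianZhai2015.thm12_fullBSD_twist)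
    (hGZ : ∀ (N : ℕ) [NeZero N] (W : WeierstrassCurve ℚ) (K : Type) [Field K] [NumberField K],
      gross_zagier N W K)
    (hHP : ∀ (W : WeierstrassCurve ℚ) (K : Type) [Field K] [NumberField K], exists_isHeegnerPoint W K)
    (hSR : ∀ (K : Type) [Field K] [NumberField K], heegnerPoints_shimuraReciprocity 49 cm7 K)
    (hM : OptimalCurveManinCertificate cm7)
    (hodd : ∀ (q : ℕ) (Δ : OrderCl.NegDiscr), q.Prime → q % 8 = 5 → Δ.D = -(4 * (q : ℤ)) →
      Odd (Nat.card ((powMonoidHom 2 : ClassGroup (OrderCl.QO Δ) →* ClassGroup (OrderCl.QO Δ)).range)))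
    (hram : ∀ (q : ℕ), q.Prime → q % 4 = 1 → ∀ (J : Type) [Field J] [CharZero J], Module.finrank ℚ J = 4 →
      ∀ (σ : J ≃ₐ[ℚ] J) (i r : J), i ^ 2 = -1 → r ^ 2 = (q : J) → σ i = i → σ r = -r →
      ∃ w : Valuation J ℝ≥0, (∀ x, w (σ x) = w x) ∧ (∀ x, w x ≤ 1 → w (σ x - x) < 1) ∧ w 2 = 1 ∧ w 7 = 1)
    (hcusp : ∀ D₀ : ModularParametrizationData cm7 49, |D₀.c| = 1 →
      D₀.cuspZeroPoint = Affine.Point.some 2 (-1) (nonsingular_cm7_baseChange_two_neg_one ℂ))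
    {q : ℕ} (hq : q.Prime) (hq8 : q % 8 = 5) (hq7 : jacobiSym q 7 = -1) (W : WeierstrassCurve ℚ) [W.IsElliptic]
    (C : VariableChange ℚ) (hC : C • W = cm7.quadraticTwist ((-q : ℤ) : ℚ)) : W.analyticRank = 1 := by
  have hmod : hasEntireLFunction_rat := hasEntireLFunction_rat_of_exists_isNewformOf hnf
  have hsq : Squarefree (-(q : ℤ)) := by
    rw [← Int.squarefree_natAbs, Int.natAbs_neg, Int.natAbs_natCast]
    exact hq.squarefree
  have hq0 : ((-q : ℤ) : ℚ) ≠ 0 := by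
    have := hq.pos
    exact_mod_cast (show (-(q : ℤ)) ≠ 0 by omega)
  haveI := cm7.isElliptic_quadraticTwist hq0
  obtain ⟨K, _, _, h2, hdK⟩ := Literature.NumberTheory.QuadraticFields.Quadratic.exists_numberField_discr_eq
    (D := 4 * (-(q : ℤ)))
    (Or.inr ⟨dvd_mul_right 4 _, by rw [show 4 * (-(q : ℤ)) / 4 = -(q : ℤ) by omega]; omega,
      by rw [show 4 * (-(q : ℤ)) / 4 = -(q : ℤ) by omega]; exact hsq⟩)
  have hK : IsImaginaryQuadratic K :=
    isImaginaryQuadratic_iff_discr_neg.mpr ⟨h2, by rw [hdK]; have := hq.pos; omega⟩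
  have hEK := analyticRankEK_cm7_eq_one_fiveModEight_of_shimuraReciprocity hnf hGZ hHP hSR hM h12 hodd hram hcusp hq
    hq8 hq7 K hK (by rw [hdK]; ring)
  have htw : cm7.quadraticTwist (NumberField.discr K : ℚ) =
      (⟨(Units.mk0 (2 : ℚ) two_ne_zero)⁻¹, 0, 0, 0⟩ : VariableChange ℚ) • cm7.quadraticTwist ((-q : ℤ) : ℚ) := by
    rw [hdK, show ((-q : ℤ) : ℚ) = ((-(q : ℤ) : ℤ) : ℚ) by push_cast; ring]
    exact quadraticTwist_cm7_four_mul (-(q : ℤ))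
  haveI : (cm7.quadraticTwist (NumberField.discr K : ℚ)).IsElliptic := by rw [htw]; infer_instance
  have hWdK : IsIsogenous W (cm7.quadraticTwist (NumberField.discr K : ℚ)) := by
    rw [htw]
    exact (isIsogenous_of_smul_eq hC).trans' (isIsogenous_smul _ _)
  rw [analyticRankEK_cm7 hmod h12 K, ← analyticRank_eq_of_isIsogenous' hWdK] at hEK
  exact hEK

/-- **K12₂″ ON THE FAMILY `49a1^{(-q)}`, `q ≡ 5 (mod 8)`, from Shimura reciprocity**: the implication of the route decl
`RankOneTwoConverseCMSevenAdditiveTwo` (item 20044) for every globally minimal model `W` of `49a1^{(-q)}` — its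
CONCLUSION holds outright under the inputs of `analyticRank_eq_one_inertPrimeTwist_fiveModEight_of_shimuraReciprocity`.
HONEST FRAMING: a density-zero prime family; nothing here closes item 20044 or proves BSD.
[cite: CoatesLiTianZhai2015, Thm. 1.4] [cite: BurungaleCastellaSkinnerTian2022, Rem. D (p. 327)] -/
theorem rankOneTwoConverse_inertPrimeTwist_fiveModEight_of_shimuraReciprocity
    (hnf : ModularForms.exists_isNewformOf) (h12 : CoatesLiTianZhai2015.thm12_fullBSD_twist)
    (hGZ : ∀ (N : ℕ) [NeZero N] (W : WeierstrassCurve ℚ) (K : Type) [Field K] [NumberField K],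
      gross_zagier N W K)
    (hHP : ∀ (W : WeierstrassCurve ℚ) (K : Type) [Field K] [NumberField K], exists_isHeegnerPoint W K)
    (hSR : ∀ (K : Type) [Field K] [NumberField K], heegnerPoints_shimuraReciprocity 49 cm7 K)
    (hM : OptimalCurveManinCertificate cm7)
    (hodd : ∀ (q : ℕ) (Δ : OrderCl.NegDiscr), q.Prime → q % 8 = 5 → Δ.D = -(4 * (q : ℤ)) →
      Odd (Nat.card ((powMonoidHom 2 : ClassGroup (OrderCl.QO Δ) →* ClassGroup (OrderCl.QO Δ)).range)))
    (hram : ∀ (q : ℕ), q.Prime → q % 4 = 1 → ∀ (J : Type) [Field J] [CharZero J], Module.finrank ℚ J = 4 →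
      ∀ (σ : J ≃ₐ[ℚ] J) (i r : J), i ^ 2 = -1 → r ^ 2 = (q : J) → σ i = i → σ r = -r →
      ∃ w : Valuation J ℝ≥0, (∀ x, w (σ x) = w x) ∧ (∀ x, w x ≤ 1 → w (σ x - x) < 1) ∧ w 2 = 1 ∧ w 7 = 1)
    (hcusp : ∀ D₀ : ModularParametrizationData cm7 49, |D₀.c| = 1 →
      D₀.cuspZeroPoint = Affine.Point.some 2 (-1) (nonsingular_cm7_baseChange_two_neg_one ℂ))
    {q : ℕ} (hq : q.Prime) (hq8 : q % 8 = 5) (hq7 : jacobiSym q 7 = -1) (W : WeierstrassCurve ℚ) [W.IsElliptic]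
    [W.IsGloballyMinimal] (C : VariableChange ℚ) (hC : C • W = cm7.quadraticTwist ((-q : ℤ) : ℚ)) :
    W.j = -3375 → ¬ W.HasGoodReductionAtPrime 2 → W.selmerCorank 2 = 1 → W.analyticRank = 1 :=
  fun _ _ _ ↦ analyticRank_eq_one_inertPrimeTwist_fiveModEight_of_shimuraReciprocity hnf h12 hGZ hHP hSR hM hodd hram
    hcusp hq hq8 hq7 W C hC

end Datum


end Summit.BirchSwinnertonDyer.BirchSwinnertonDyer.Theorems.GoldfeldGoodTwists

end
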